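import Summits.KontsevichZagierPeriods.KontsevichZagierPeriods.Theorems.RootDecompQuadraticDescentLegendreData

/-!
# The LEGENDRE AUTOPSY for `QuadraticDescent` (stmt-KontsevichZagierPeriods-26540) — part 2/3: the two-dimensional machinery (open square, Fubini, arctangent fibre integral), products of KZ-rational representations, the natively KZ-RATIONAL `XK c`, `XE c` (values `π·K c`, `π·E c`), the product algebra modulo relations and ideal bookkeeping

Theorems-split (≤ 400 lines each) of the decomp-kz lens-6 gen-4 file
`run/shared/lean/pub/decomp-kz/decomp-kz-lens-6/g4/RootDecompQuadraticDescentLegendre.lean` (778 lines; critic CONFIRMED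
2026-08-30T04:24:12Z: rc0 / 0 warn / std axioms, axioms(legendre_improper) = {propext, Classical.choice, Quot.sound}); parts
`…LegendreData` → `…LegendrePairs` → `…Legendre`. `LegendreRelation c` (K·E′ + E·K′ − K·K′ = π/2 for y² = t⁴ ± ct² + 1, |c| < 2)
is a PRINTED HYPOTHESIS, not proved here. Support (T5 evidence) for 26540; the named residue `LegendreByMoves` is an
instrument target of 26541 / 24769. Sources: Legendre 1825; Whittaker–Watson §22.736; Kontsevich–Zagier 2001 §1.2, §2.2.
-/

noncomputable section

set_option linter.dupNamespace false

open MeasureTheory Set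
open MvPolynomial (aeval X C)
open Literature.ModelTheory.ExponentialFields (IsSemialgebraic tarski_seidenberg_real_holds)

namespace Summit.KontsevichZagierPeriods.KontsevichZagierPeriods.Theorems.RootDecompQuadraticDescentLegendre

open Literature.NumberTheory.Transcendental
open Literature.NumberTheory.Transcendental.KZ

section LegendreAutopsy

variable {c : ℚ}

/-! ### Two-dimensional machinery: the open square, Fubini, the arctangent fibre integral -/

/-- The open unit square as a subset of `ℝ²`. -/
def Sq2 : Set (Fin 2 → ℝ) := {x | ∀ j, x j ∈ Set.Ioo (0:ℝ) 1}

/-- `Sq2` is `ℚ`-semialgebraic. [BCR1998 §2.2] -/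
lemma isSemialgebraic_Sq2 : IsSemialgebraic ℚ Sq2 := KZ.isSemialgebraic_box 2

/-- `Sq2` is measurable. [bookkeeping] -/
lemma measurableSet_Sq2 : MeasurableSet Sq2 := by
  rw [Sq2, box_two_eq_preimage]
  exact MeasurableEquiv.finTwoArrow.measurable (measurableSet_Ioo.prod measurableSet_Ioo)

/-- Set integral over `Sq2` rewritten in one variable. [bookkeeping] -/
lemma setIntegral_Sq2 (G : ℝ → ℝ → ℝ) :
    ∫ x in Sq2, G (x 0) (x 1) = ∫ p in Set.Ioo (0:ℝ) 1 ×ˢ Set.Ioo (0:ℝ) 1, G p.1 p.2 :=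
  setIntegral_box_two_eq (fun p => G p.1 p.2)

/-- Integrability on the relevant piece (`integrableOn_Sq2_iff`). [bookkeeping] -/
lemma integrableOn_Sq2_iff (G : ℝ → ℝ → ℝ) :
    IntegrableOn (fun x : Fin 2 → ℝ => G (x 0) (x 1)) Sq2 volume ↔
      IntegrableOn (fun p : ℝ × ℝ => G p.1 p.2) (Set.Ioo (0:ℝ) 1 ×ˢ Set.Ioo (0:ℝ) 1) volume :=
  integrableOn_box_two_iff (fun p => G p.1 p.2)

/-- The fibre kernel `m(t)·(4/(y²+Q(t)) + 4/(1+Q(t)y²))` whose `y`-integral over `(0,1)` is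
`m(t)·2π/√Q(t)` — the device making `π·(∫ m/√Q)` the value of a KZ-RATIONAL 2-dimensional
representation. -/
def Gfun (m Qf : ℝ → ℝ) (t y : ℝ) : ℝ := m t * (4 / (y ^ 2 + Qf t) + 4 / (1 + Qf t * y ^ 2))

/-- Auxiliary step `continuous_Gfun`. [bookkeeping] -/
lemma continuous_Gfun {m Qf : ℝ → ℝ} (hm : Continuous m) (hQ : Continuous Qf) (hQpos : ∀ t, 0 < Qf t) :
    Continuous (fun p : ℝ × ℝ => Gfun m Qf p.1 p.2) := by
  unfold Gfun
  have h1 : Continuous fun p : ℝ × ℝ => p.2 ^ 2 + Qf p.1 := by fun_prop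
  have h2 : Continuous fun p : ℝ × ℝ => 1 + Qf p.1 * p.2 ^ 2 := by fun_prop
  refine (hm.comp continuous_fst).mul ((continuous_const.div h1 fun p => ?_).add
    (continuous_const.div h2 fun p => ?_))
  · have := hQpos p.1; positivity
  · have := hQpos p.1; positivity

/-- Integrability on the relevant piece (`integrableOn_Gfun`). [bookkeeping] -/
lemma integrableOn_Gfun {m Qf : ℝ → ℝ} (hm : Continuous m) (hQ : Continuous Qf) (hQpos : ∀ t, 0 < Qf t) :
    IntegrableOn (fun p : ℝ × ℝ => Gfun m Qf p.1 p.2) (Set.Ioo (0:ℝ) 1 ×ˢ Set.Ioo (0:ℝ) 1) volume :=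
  ((continuous_Gfun hm hQ hQpos).continuousOn.integrableOn_compact
    (isCompact_Icc.prod isCompact_Icc)).mono_set (Set.prod_mono Set.Ioo_subset_Icc_self Set.Ioo_subset_Icc_self)

/-- `∫₀¹ (4/(y²+Q) + 4/(1+Qy²)) dy = 2π/√Q` for `Q > 0` (primitive
`(4/√Q)(arctan(y/√Q) + arctan(√Q·y))`, and `arctan(1/s) + arctan(s) = π/2`). -/
lemma inner_arctan (Q : ℝ) (hQ : 0 < Q) :
    ∫ y in Set.Ioo (0:ℝ) 1, (4 / (y ^ 2 + Q) + 4 / (1 + Q * y ^ 2)) = 2 * Real.pi / Real.sqrt Q := by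
  set s := Real.sqrt Q with hs_def
  have hs : 0 < s := Real.sqrt_pos.2 hQ
  have hs2 : s ^ 2 = Q := Real.sq_sqrt hQ.le
  have hderiv : ∀ y ∈ Set.uIcc (0:ℝ) 1,
      HasDerivAt (fun y => 4 / s * (Real.arctan (y / s) + Real.arctan (s * y)))
        (4 / (y ^ 2 + Q) + 4 / (1 + Q * y ^ 2)) y := by
    intro y _
    have h1 := (Real.hasDerivAt_arctan (id y / s)).comp y ((hasDerivAt_id y).div_const s)
    have h2 := (Real.hasDerivAt_arctan (s * id y)).comp y ((hasDerivAt_id y).const_mul s)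
    refine ((h1.add h2).const_mul (4 / s)).congr_deriv ?_
    simp only [id]
    rw [← hs2]
    field_simp
    ring
  have hcont : Continuous fun y : ℝ => 4 / (y ^ 2 + Q) + 4 / (1 + Q * y ^ 2) :=
    (continuous_const.div (by fun_prop) fun y => by positivity).add
      (continuous_const.div (by fun_prop) fun y => by positivity)
  rw [← integral_Ioc_eq_integral_Ioo, ← intervalIntegral.integral_of_le zero_le_one,
    intervalIntegral.integral_eq_sub_of_hasDerivAt hderiv (hcont.intervalIntegrable 0 1)]
  simp only [zero_div, mul_zero, Real.arctan_zero, add_zero, mul_one]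
  rw [one_div, Real.arctan_inv_of_pos hs]
  field_simp
  ring

/-- FUBINI + ARCTANGENT: `∬_{(0,1)²} m(t)(4/(y²+Q)+4/(1+Qy²)) = π ∫₀¹ 2m/√Q`. -/
lemma setIntegral_Gfun {m Qf : ℝ → ℝ} (hm : Continuous m) (hQ : Continuous Qf) (hQpos : ∀ t, 0 < Qf t) :
    ∫ p in Set.Ioo (0:ℝ) 1 ×ˢ Set.Ioo (0:ℝ) 1, Gfun m Qf p.1 p.2 =
      Real.pi * ∫ t in Set.Ioo (0:ℝ) 1, 2 * m t / Real.sqrt (Qf t) := by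
  have hint := integrableOn_Gfun hm hQ hQpos
  rw [Measure.volume_eq_prod] at hint ⊢
  rw [setIntegral_prod _ hint]
  have hin : ∀ t ∈ Set.Ioo (0:ℝ) 1,
      ∫ y in Set.Ioo (0:ℝ) 1, Gfun m Qf t y = Real.pi * (2 * m t / Real.sqrt (Qf t)) := by
    intro t _
    unfold Gfun
    rw [integral_const_mul, inner_arctan _ (hQpos t)]
    ring
  rw [setIntegral_congr_fun measurableSet_Ioo hin, integral_const_mul]

/-- THE VALUE OF A SQUARE REPRESENTATION WITH A `Gfun` INTEGRAND. -/
lemma value_of_Gfun (X : KZ.IntegralRep 2) {m Qf : ℝ → ℝ} (hm : Continuous m) (hQ : Continuous Qf)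
    (hQpos : ∀ t, 0 < Qf t) (hd : X.domain = Sq2)
    (hi : Set.EqOn X.integrand (fun x => Gfun m Qf (x 0) (x 1)) Sq2) :
    X.value = Real.pi * ∫ t in Set.Ioo (0:ℝ) 1, 2 * m t / Real.sqrt (Qf t) := by
  rw [KZ.IntegralRep.value, hd, setIntegral_congr_fun measurableSet_Sq2 hi, setIntegral_Sq2 (Gfun m Qf),
    setIntegral_Gfun hm hQ hQpos]

/-! ### Products of KZ-rational representations are KZ-rational -/

/-- `prod` is KZ-rational. [bookkeeping] -/
theorem isRational_prod {n m : ℕ} {r : KZ.IntegralRep n} {s : KZ.IntegralRep m}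
    (hr : r.IsRational) (hs : s.IsRational) : (r.prod s).IsRational := by
  obtain ⟨p, q, hq, hpq⟩ := hr
  obtain ⟨p', q', hq', hpq'⟩ := hs
  refine ⟨MvPolynomial.rename (Fin.castAdd m) p * MvPolynomial.rename (Fin.natAdd n) p',
    MvPolynomial.rename (Fin.castAdd m) q * MvPolynomial.rename (Fin.natAdd n) q',
    fun z hz => ?_, fun z hz => ?_⟩
  · have hz' : (fun i => z (Fin.castAdd m i)) ∈ r.domain ∧ (fun j => z (Fin.natAdd n j)) ∈ s.domain := by
      simpa only [IntegralRep.prod_domain, IntegralRep.mem_prodDomain] using hz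
    simp only [map_mul, MvPolynomial.aeval_rename]
    exact mul_ne_zero (hq _ hz'.1) (hq' _ hz'.2)
  · have hz' : (fun i => z (Fin.castAdd m i)) ∈ r.domain ∧ (fun j => z (Fin.natAdd n j)) ∈ s.domain := by
      simpa only [IntegralRep.prod_domain, IntegralRep.mem_prodDomain] using hz
    rw [IntegralRep.prod_integrand_eq, IntegralRep.prodFun_apply, hpq hz'.1, hpq' hz'.2]
    simp only [map_mul, MvPolynomial.aeval_rename, div_mul_div_comm]
    rfl

/-- `W := P × P` — KZ-rational, dimension `2`, value `π²`. -/
def W : KZ.IntegralRep (1 + 1) := P.prod P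

/-- `W` is KZ-rational. [bookkeeping] -/
lemma isRational_W : W.IsRational := isRational_prod isRational_P isRational_P

/-- The value of `W`. [bookkeeping] -/
lemma value_W : W.value = Real.pi ^ 2 := by
  rw [W, KZ.IntegralRep.value_prod, value_P, sq]

/-! ### The natively KZ-RATIONAL two-dimensional representations `XK c`, `XE c` of `π·K c`, `π·E c` -/

/-- Numerator of `XK`: `4((1 + Q y²) + (y² + Q))`. -/
def pK (c : ℚ) : MvPolynomial (Fin 2) ℚ := C 4 * ((1 + Qpoly 1 c * X 1 ^ 2) + (X 1 ^ 2 + Qpoly 1 c))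
/-- Denominator of `XK`: `(y² + Q)(1 + Q y²)`. -/
def qK (c : ℚ) : MvPolynomial (Fin 2) ℚ := (X 1 ^ 2 + Qpoly 1 c) * (1 + Qpoly 1 c * X 1 ^ 2)
/-- Numerator of `XE`: `4 Q ((1 + Q y²) + (y² + Q))`. -/
def pE (c : ℚ) : MvPolynomial (Fin 2) ℚ :=
  C 4 * Qpoly 1 c * ((1 + Qpoly 1 c * X 1 ^ 2) + (X 1 ^ 2 + Qpoly 1 c))
/-- Denominator of `XE`: `(1+t²)² (y² + Q)(1 + Q y²)`. -/
def qE (c : ℚ) : MvPolynomial (Fin 2) ℚ :=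
  (1 + X 0 ^ 2) ^ 2 * ((X 1 ^ 2 + Qpoly 1 c) * (1 + Qpoly 1 c * X 1 ^ 2))

/-- Auxiliary step `aeval_pK`. [bookkeeping] -/
@[simp] lemma aeval_pK (x : Fin 2 → ℝ) :
    aeval x (pK c) = 4 * ((1 + Qr c (x 0) * (x 1) ^ 2) + ((x 1) ^ 2 + Qr c (x 0))) := by
  simp [pK, map_add, map_mul, map_pow]
/-- Auxiliary step `aeval_qK`. [bookkeeping] -/
@[simp] lemma aeval_qK (x : Fin 2 → ℝ) :
    aeval x (qK c) = ((x 1) ^ 2 + Qr c (x 0)) * (1 + Qr c (x 0) * (x 1) ^ 2) := by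
  simp [qK, map_add, map_mul, map_pow]
/-- Auxiliary step `aeval_pE`. [bookkeeping] -/
@[simp] lemma aeval_pE (x : Fin 2 → ℝ) :
    aeval x (pE c) = 4 * Qr c (x 0) * ((1 + Qr c (x 0) * (x 1) ^ 2) + ((x 1) ^ 2 + Qr c (x 0))) := by
  simp [pE, map_add, map_mul, map_pow]
/-- Auxiliary step `aeval_qE`. [bookkeeping] -/
@[simp] lemma aeval_qE (x : Fin 2 → ℝ) :
    aeval x (qE c) = (1 + (x 0) ^ 2) ^ 2 * (((x 1) ^ 2 + Qr c (x 0)) * (1 + Qr c (x 0) * (x 1) ^ 2)) := by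
  simp [qE, map_add, map_mul, map_pow]

/-- Auxiliary step `continuous_Qr`. [bookkeeping] -/
lemma continuous_Qr (c : ℚ) : Continuous (Qr c) := by unfold Qr; fun_prop

/-- Auxiliary step `GfunK_eq`. [bookkeeping] -/
lemma GfunK_eq (hc : -2 < c) (hc' : c < 2) (x : Fin 2 → ℝ) :
    aeval x (pK c) / aeval x (qK c) = Gfun (fun _ => 1) (Qr c) (x 0) (x 1) := by
  have hQ := Qr_pos hc hc' (x 0)
  rw [aeval_pK, aeval_qK, Gfun]
  field_simp

/-- Auxiliary step `GfunE_eq`. [bookkeeping] -/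
lemma GfunE_eq (hc : -2 < c) (hc' : c < 2) (x : Fin 2 → ℝ) :
    aeval x (pE c) / aeval x (qE c) = Gfun (fun t => Qr c t / (1 + t ^ 2) ^ 2) (Qr c) (x 0) (x 1) := by
  have hQ := Qr_pos hc hc' (x 0)
  rw [aeval_pE, aeval_qE, Gfun]
  field_simp

/-- `XK c := [(0,1)², 4((1+Qy²)+(y²+Q)) / ((y²+Q)(1+Qy²))]` — natively KZ-RATIONAL, dimension `2`,
value `π·K c` (the fibre `y`-integral is `2π/√Q_c(t)`). -/
def XK (c : ℚ) (hc : -2 < c) (hc' : c < 2) : KZ.IntegralRep 2 :=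
  KZ.IntegralRep.ofRational Sq2 (pK c) (qK c) isSemialgebraic_Sq2
    (fun x _ => by have := Qr_pos hc hc' (x 0); rw [aeval_qK]; positivity)
    (by
      have h := (integrableOn_Sq2_iff (Gfun (fun _ => 1) (Qr c))).2
        (integrableOn_Gfun continuous_const (continuous_Qr c) (Qr_pos hc hc'))
      exact h.congr_fun (fun x _ => (GfunK_eq hc hc' x).symm) measurableSet_Sq2)

/-- `XE c := [(0,1)², 4Q((1+Qy²)+(y²+Q)) / ((1+t²)²(y²+Q)(1+Qy²))]` — natively KZ-RATIONAL,
dimension `2`, value `π·E c`. -/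
def XE (c : ℚ) (hc : -2 < c) (hc' : c < 2) : KZ.IntegralRep 2 :=
  KZ.IntegralRep.ofRational Sq2 (pE c) (qE c) isSemialgebraic_Sq2
    (fun x _ => by have := Qr_pos hc hc' (x 0); rw [aeval_qE]; positivity)
    (by
      have hm : Continuous fun t : ℝ => Qr c t / (1 + t ^ 2) ^ 2 :=
        (continuous_Qr c).div (by fun_prop) fun t => by positivity
      have h := (integrableOn_Sq2_iff (Gfun (fun t => Qr c t / (1 + t ^ 2) ^ 2) (Qr c))).2
        (integrableOn_Gfun hm (continuous_Qr c) (Qr_pos hc hc'))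
      exact h.congr_fun (fun x _ => (GfunE_eq hc hc' x).symm) measurableSet_Sq2)

/-- `XK` is KZ-rational. [bookkeeping] -/
lemma isRational_XK (hc : -2 < c) (hc' : c < 2) : (XK c hc hc').IsRational :=
  KZ.IntegralRep.isRational_ofRational _ _ _ _ _ _
/-- `XE` is KZ-rational. [bookkeeping] -/
lemma isRational_XE (hc : -2 < c) (hc' : c < 2) : (XE c hc hc').IsRational :=
  KZ.IntegralRep.isRational_ofRational _ _ _ _ _ _

/-- `value (XK c) = π · K c`. -/
theorem value_XK (hc : -2 < c) (hc' : c < 2) : (XK c hc hc').value = Real.pi * K c := by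
  rw [value_of_Gfun (XK c hc hc') continuous_const (continuous_Qr c) (Qr_pos hc hc') rfl
    (fun x _ => by rw [XK, KZ.IntegralRep.integrand_ofRational]; exact GfunK_eq hc hc' x), K]
  congr 1
  refine setIntegral_congr_fun measurableSet_Ioo fun t _ => ?_
  ring

/-- `value (XE c) = π · E c`. -/
theorem value_XE (hc : -2 < c) (hc' : c < 2) : (XE c hc hc').value = Real.pi * E c := by
  have hm : Continuous fun t : ℝ => Qr c t / (1 + t ^ 2) ^ 2 :=
    (continuous_Qr c).div (by fun_prop) fun t => by positivity
  rw [value_of_Gfun (XE c hc hc') hm (continuous_Qr c) (Qr_pos hc hc') rfl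
    (fun x _ => by rw [XE, KZ.IntegralRep.integrand_ofRational]; exact GfunE_eq hc hc' x), E]
  congr 1
  refine setIntegral_congr_fun measurableSet_Ioo fun t _ => ?_
  have hQ := Qr_pos hc hc' t
  have hs : Real.sqrt (Qr c t) ≠ 0 := (Real.sqrt_pos.2 hQ).ne'
  rw [show 2 * (Qr c t / (1 + t ^ 2) ^ 2) / Real.sqrt (Qr c t) =
      2 * (Qr c t / Real.sqrt (Qr c t)) / (1 + t ^ 2) ^ 2 by field_simp, Real.div_sqrt]

/-! ### Product algebra modulo `KZ.relations` (relabelling moves; proofs as in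
`Theorems/TerasomaMultiplicationTriplicationFromMultiplicationAlgebra`, restated here because that
module is not importable into a route file) -/

section ProdAlgebra
variable {l m n l' m' : ℕ}

/-- Auxiliary step `prod_comm'`. [bookkeeping] -/
theorem prod_comm' (r : KZ.IntegralRep n) (s : KZ.IntegralRep m) : Equivalent (r.prod s) (s.prod r) := by
  have h := of_sub_of_reindex_mem_relations (s.prod r) finAddFlip
  rw [← IntegralRep.prod_eq_reindex_prod r s] at h
  exact Equivalent.symm h

/-- Auxiliary step `prod_assoc'`. [bookkeeping] -/
theorem prod_assoc' (t : KZ.IntegralRep l) (s : KZ.IntegralRep m) (r : KZ.IntegralRep n) :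
    Equivalent (t.prod (s.prod r)) ((t.prod s).prod r) := by
  let e : Fin (l + m + n) ≃ Fin (l + (m + n)) := finCongr (Nat.add_assoc l m n)
  have key : t.prod (s.prod r) = ((t.prod s).prod r).reindex e := by
    have h1 : ∀ (w : Fin (l + (m + n)) → ℝ) (i : Fin l),
        w (e (Fin.castAdd n (Fin.castAdd m i))) = w (Fin.castAdd (m + n) i) := by
      intro w i; congr 1
    have h2 : ∀ (w : Fin (l + (m + n)) → ℝ) (j : Fin m),
        w (e (Fin.castAdd n (Fin.natAdd l j))) = w (Fin.natAdd l (Fin.castAdd n j)) := by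
      intro w j; congr 1
    have h3 : ∀ (w : Fin (l + (m + n)) → ℝ) (j : Fin n),
        w (e (Fin.natAdd (l + m) j)) = w (Fin.natAdd l (Fin.natAdd m j)) := by
      intro w j; congr 1; ext; simp [e, Nat.add_assoc]
    refine IntegralRep.ext' ?_ ?_
    · ext w
      simp only [IntegralRep.prod_domain, IntegralRep.mem_prodDomain, IntegralRep.reindex_domain,
        mem_setOf_eq, h1, h2, h3]
      exact and_assoc.symm
    · rw [IntegralRep.reindex_integrand, IntegralRep.prod_integrand_eq, IntegralRep.prod_integrand_eq]
      funext w
      simp only [IntegralRep.prodFun, IntegralRep.prod_integrand_eq, h1, h2, h3, mul_assoc]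
  rw [key]
  exact Equivalent.symm (of_sub_of_reindex_mem_relations ((t.prod s).prod r) e)

/-- Auxiliary step `swap12'`. [bookkeeping] -/
theorem swap12' (a : KZ.IntegralRep l) (b : KZ.IntegralRep m) (T : KZ.IntegralRep n) :
    Equivalent (a.prod (b.prod T)) (b.prod (a.prod T)) :=
  ((prod_assoc' a b T).trans (Equivalent.prod (prod_comm' a b) (Equivalent.refl T))).trans
    (prod_assoc' b a T).symm

/-- **Regrouping** `(a × b) × (c × d) ∼ (a × c) × (b × d)` (relabelling moves). -/
theorem regroup (a : KZ.IntegralRep l) (b : KZ.IntegralRep m) (c' : KZ.IntegralRep l') (d : KZ.IntegralRep m') :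
    Equivalent ((a.prod b).prod (c'.prod d)) ((a.prod c').prod (b.prod d)) :=
  ((prod_assoc' a b (c'.prod d)).symm.trans (Equivalent.prod (Equivalent.refl a) (swap12' b c' d))).trans
    (prod_assoc' a c' (b.prod d))

end ProdAlgebra

/-! ### Ideal bookkeeping in an admissible `R` -/

/-- Auxiliary step `sub_mul_mem`. [bookkeeping] -/
lemma sub_mul_mem {R : AddSubgroup KZ.FormalRep}
    (hI : ∀ c ∈ R, ∀ y : KZ.FormalRep, c * y ∈ R ∧ y * c ∈ R)
    {a a' b b' : KZ.FormalRep} (ha : a - a' ∈ R) (hb : b - b' ∈ R) : a * b - a' * b' ∈ R := by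
  have h := R.add_mem (hI _ ha b).1 (hI _ hb a').2
  convert h using 1
  rw [sub_mul, mul_sub]
  abel

/-- One product step: if `[X_F] ≡ [P × A_F]`, `[X_G] ≡ [P × A_G]` mod `R` and `A_F × A_G ∼ H`, then
`[X_F]·[X_G] ≡ [W]·[H]` mod `R` (regrouping `(P×A_F)×(P×A_G) ∼ (P×P)×(A_F×A_G)`). -/
lemma prod_step {R : AddSubgroup KZ.FormalRep} (hR : KZ.relations ≤ R)
    (hI : ∀ c ∈ R, ∀ y : KZ.FormalRep, c * y ∈ R ∧ y * c ∈ R)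
    {a b k : ℕ} {XF XG : KZ.IntegralRep 2} {AF : KZ.IntegralRep a} {AG : KZ.IntegralRep b}
    {H : KZ.IntegralRep k}
    (hXF : of XF - of (P.prod AF) ∈ R) (hXG : of XG - of (P.prod AG) ∈ R) (hA : Equivalent (AF.prod AG) H) :
    of XF * of XG - of W * of H ∈ R := by
  have h1 : of XF * of XG - of (P.prod AF) * of (P.prod AG) ∈ R := sub_mul_mem hI hXF hXG
  have h2 : of (P.prod AF) * of (P.prod AG) - of W * of H ∈ relations := by
    rw [of_mul_of, of_mul_of, W]
    exact (regroup P AF P AG).trans (Equivalent.prod (Equivalent.refl _) hA)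
  have h := R.add_mem h1 (hR h2)
  convert h using 1
  abel

end LegendreAutopsy

end Summit.KontsevichZagierPeriods.KontsevichZagierPeriods.Theorems.RootDecompQuadraticDescentLegendre
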